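import Literature.Analysis.FluidPDE.LeiZhang2011LowerMassCore
import Literature.Analysis.FluidPDE.LeiZhang2011MeanValue
import Literature.Analysis.FluidPDE.LeiZhang2011StreamL6
import Literature.Analysis.FluidPDE.NashNonlinearities
import Literature.Analysis.FluidPDE.HolderThreeHalves
import Literature.Analysis.FluidPDE.LeiZhang2011LogSlice
import HarnessLib

/-!
# Lei–Zhang 2011, Lemma 3.4 in the tree's form: a lower bound of the mass of `Φ` on a cylinder

Analysis/FluidPDE proofs file (theorems only), on the discharge path of the named fact
`Literature.Analysis.FluidPDE.LeiZhang2011_liouville` (Z. Lei, Q. S. Zhang, J. Funct. Anal. 261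
(2011) = arXiv:1011.5066). Lemma 3.4 (p. 11): for the normalised nonnegative solution `Φ` of (1.5),
which is a constant `a ≥ 1` on the axis, `R^{-5/p}‖Φ‖_{L^p(P(R,R/2))} ≥ C^{-1}K(‖b‖_E)^{-2/p} a`
for `p ∈ (0, 1)`; it is used to verify the hypothesis (3.1) `‖Φ‖_{L¹(P(R/2))} ≥ c₀R⁵` of
Lemma 3.2. Here, from the analytic core `lower_mass_core` (the paper's test-function computation
(3.19)–(3.24)) with the cut-offs of `LeiZhang2011Cutoff`, the clamped power `H = χ_ε^{1/4}` of
`NashNonlinearities` and the John–Nirenberg `L⁶` bound, all integrabilities discharged as in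
`reverse_holder_between_cylinders`: for every `BMO` bound `C_B` there is `c > 0` such that for
every radius `ρ`, every `0 < ε ≤ 1` and every solution `F = Φ + ε` in the setting at radius `ρ`
with `ε ≤ F ≤ 3` on the cylinder and `F ≥ 1` on its axis,
`c ρ⁵ ≤ ∫_{−ρ²}^0 ∫_{B̄(0,ρ)} F^{1/4}` (`LeiZhang2011.lower_mass`).

## References

* Z. Lei, Q. S. Zhang, J. Funct. Anal. 261 (2011) = arXiv:1011.5066, Lemma 3.4 and its proof,
  p. 11. [LeiZhang2011]
-/

noncomputable section

open MeasureTheory Set Function Filter Metric intervalIntegral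
open _root_.Topology
open scoped InnerProductSpace RealInnerProductSpace NNReal ENNReal Laplacian

namespace Literature.Analysis.FluidPDE

namespace LeiZhang2011

open Literature.Analysis.FunctionSpaces Literature.Analysis.Pluripotential

/-- The two-case lower bound behind Lemma 3.4: if `B ≤ a X + b X^{2/3}` with `a, b, B > 0`,
`X ≥ 0`, then `X ≥ min (B/(2a)) ((B/(2b))^{3/2})`. [folklore] -/
theorem le_of_le_add_rpow_two_thirds {B a b X : ℝ} (hB : 0 < B) (ha : 0 < a) (hb : 0 < b) (hX : 0 ≤ X)
    (h : B ≤ a * X + b * X ^ (2 / (3 : ℝ))) :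
    min (B / (2 * a)) ((B / (2 * b)) ^ (3 / (2 : ℝ))) ≤ X := by
  by_cases h1 : B / 2 ≤ a * X
  · refine (min_le_left _ _).trans ?_
    rw [div_le_iff₀ (by positivity)]
    nlinarith
  · push Not at h1
    have h2 : B / 2 ≤ b * X ^ (2 / (3 : ℝ)) := by linarith
    refine (min_le_right _ _).trans ?_
    have h3 : B / (2 * b) ≤ X ^ (2 / (3 : ℝ)) := by
      rw [div_le_iff₀ (by positivity)]; linarith
    calc (B / (2 * b)) ^ (3 / (2 : ℝ)) ≤ (X ^ (2 / (3 : ℝ))) ^ (3 / (2 : ℝ)) :=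
          Real.rpow_le_rpow (by positivity) h3 (by norm_num)
      _ = X := by rw [← Real.rpow_mul hX]; norm_num

set_option maxHeartbeats 800000 in
-- one long assembly proof (cut-offs, integrability bookkeeping, the core estimate, constants)
/-- **Lemma 3.4 of Lei–Zhang 2011 (tree form): lower bound of the mass on the cylinder.** For
every `BMO` bound `C_B` there is `c > 0` such that for every radius `ρ > 0`, every `0 < ε ≤ 1`
and every solution `F` in the setting at radius `ρ` (hypotheses as in
`reverse_holder_between_cylinders`, without the vanishing on the axis) with `ε ≤ F ≤ 3` on
`[−ρ², 0] × B̄(0, ρ)` and `F ≥ 1` at the axis points `(0,0,z)`, `|z| ≤ ρ`, of the cylinder,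
`c ρ⁵ ≤ ∫_{−ρ²}^0 ∫_{B̄(0,ρ)} F^{1/4}`. [cite: LeiZhang2011, Lemma 3.4 (arXiv p. 11)] -/
theorem lower_mass (CB : ℝ≥0) :
    ∃ cl : ℝ, 0 < cl ∧ ∀ ⦃ρ : ℝ⦄, 0 < ρ → ∀ ⦃ε : ℝ⦄, 0 < ε → ε ≤ 1 →
      ∀ ⦃F N : ℝ → EuclideanSpace ℝ (Fin 3) → ℝ⦄
        ⦃b Bst : ℝ → EuclideanSpace ℝ (Fin 3) → EuclideanSpace ℝ (Fin 3)⦄,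
      (∀ s, ContDiff ℝ 2 (F s)) → (∀ s, IsAxisymmetricScalar (F s)) →
      (∀ s, LocallyIntegrable (b s) volume) →
      (∀ᵐ s ∂(volume.restrict (Ioc (-ρ ^ 2) 0)),
        Differentiable ℝ (Bst s) ∧ curl (Bst s) =ᵐ[volume] b s ∧ eBMOSeminormVec (Bst s) ≤ CB) →
      (∀ s x, N s x =
        (Δ (F s)) x - fderiv ℝ (F s) x (b s x) - 2 / cylRadius x * fderiv ℝ (F s) x (eR x)) →
      (∀ᵐ x ∂(volume : Measure (EuclideanSpace ℝ (Fin 3))),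
        IntervalIntegrable (fun s => N s x) volume (-ρ ^ 2) 0 ∧
          ∀ s ∈ Icc (-ρ ^ 2) 0, F s x = F (-ρ ^ 2) x + ∫ τ in (-ρ ^ 2)..s, N τ x) →
      (Continuous fun p : ℝ × EuclideanSpace ℝ (Fin 3) => F p.1 p.2) →
      (Continuous fun p : ℝ × EuclideanSpace ℝ (Fin 3) => gradient (F p.1) p.2) →
      AEStronglyMeasurable (fun p : ℝ × EuclideanSpace ℝ (Fin 3) => N p.1 p.2)
        ((volume.restrict (Ioc (-ρ ^ 2) 0)).prod volume) →
      Integrable (fun p : ℝ × EuclideanSpace ℝ (Fin 3) => N p.1 p.2)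
        ((volume.restrict (Ioc (-ρ ^ 2) 0)).prod (volume.restrict (closedBall 0 ρ))) →
      AEStronglyMeasurable (fun p : ℝ × EuclideanSpace ℝ (Fin 3) => b p.1 p.2)
        ((volume.restrict (Ioc (-ρ ^ 2) 0)).prod volume) →
      ∀ ⦃Mb : ℝ⦄, (∀ s, ∀ x ∈ closedBall (0 : EuclideanSpace ℝ (Fin 3)) ρ, ‖b s x‖ ≤ Mb) →
      (∀ s ∈ Icc (-ρ ^ 2) 0, ∀ x ∈ closedBall (0 : EuclideanSpace ℝ (Fin 3)) ρ, ε ≤ F s x ∧ F s x ≤ 3) →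
      (∀ s ∈ Icc (-ρ ^ 2) 0, ∀ z : ℝ, |z| ≤ ρ → 1 ≤ F s (meridianPoint (0, z))) →
      cl * ρ ^ 5 ≤ ∫ s in (-ρ ^ 2)..0, ∫ x in closedBall (0 : EuclideanSpace ℝ (Fin 3)) ρ, F s x ^ (1 / 4 : ℝ) := by
  -- the absolute constants
  obtain ⟨Cφ, hCφ0, hCφ⟩ := exists_norm_gradient_radialCutoff_le
  obtain ⟨CT, hCT0, hCT⟩ := exists_abs_deriv_smoothTransition_le
  obtain ⟨CJ, hCJ0, hCJ⟩ := exists_setIntegral_norm_sub_sq_cube_le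
  have hc₂ : 0 < radialConst₂ := radialConst₂_pos
  set V₁ : ℝ := volume.real (ball (0 : EuclideanSpace ℝ (Fin 3)) 1) with hV₁
  have hV₁0 : 0 ≤ V₁ := measureReal_nonneg
  -- `p = 1/4`, `κ = 1/3`; the coefficients of the final inequality `2πρ³ ≤ (a₁/ρ²) X + a₂ ρ^{-1/3} X^{2/3}`
  set a₁ : ℝ := 16 * (1 / 3) * Cφ ^ 2 + 128 * CT / 3 + 1 with ha₁
  set a₂ : ℝ := 16 * (1 / 3) * Cφ ^ 2 * (CJ * (CB : ℝ) ^ 2 * V₁ ^ (1 / (3 : ℝ))) * (3 : ℝ) ^ ((1 / 4 : ℝ) / 3) + 1 with ha₂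
  have ha₁0 : 0 < a₁ := by positivity
  have ha₂0 : 0 < a₂ := by positivity
  refine ⟨min (radialConst₂ / (2 * a₁)) ((radialConst₂ / (2 * a₂)) ^ (3 / (2 : ℝ))), by positivity, ?_⟩
  intro ρ hρ ε hε hε1 F N b Bst hF2 hFa hb hBst hN heq hFc hF1c hNm hNi hbm Mb hbB hFb hFax
  -- ### the radii `r₁ = ρ`, `r₂ = ρ/2` (opaque names, as in `reverse_holder_between_cylinders`)
  obtain ⟨r₁, hr₁e⟩ : ∃ r₁ : ℝ, r₁ = ρ := ⟨ρ, rfl⟩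
  obtain ⟨r₂, hr₂e⟩ : ∃ r₂ : ℝ, r₂ = ρ / 2 := ⟨ρ / 2, rfl⟩
  have hr₂ : 0 < r₂ := by rw [hr₂e]; positivity
  have hr : r₂ < r₁ := by rw [hr₁e, hr₂e]; linarith
  have hr₁ : r₁ ≤ ρ := by rw [hr₁e]
  -- ### elementary facts on the radii
  have hr₁0 : 0 < r₁ := hr₂.trans hr
  have hT : r₂ ^ 2 < r₁ ^ 2 := by nlinarith
  have hT₂ : 0 < r₂ ^ 2 := by positivity
  have hρle : -ρ ^ 2 ≤ -r₁ ^ 2 := by rw [hr₁e]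
  have hn0 : -r₁ ^ 2 ≤ (0 : ℝ) := by nlinarith
  have hn1 : -r₁ ^ 2 ≤ -r₁ ^ 2 + r₁ ^ 2 / 4 := by nlinarith
  have hn2 : -r₁ ^ 2 + r₁ ^ 2 / 4 ≤ -(r₁ ^ 2 / 4) := by nlinarith
  have hn3 : -(r₁ ^ 2 / 4) ≤ (0 : ℝ) := by nlinarith
  have hsub0 : 0 < r₁ ^ 2 - r₂ ^ 2 := sub_pos.2 hT
  have hr₁half : -(r₁ / 2) ≤ r₁ / 2 := by nlinarith
  have hI : Ioc (-r₁ ^ 2) (0 : ℝ) ⊆ Ioc (-ρ ^ 2) 0 := Ioc_subset_Ioc hρle le_rfl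
  have hIcc : Icc (-r₁ ^ 2) (0 : ℝ) ⊆ Icc (-ρ ^ 2) 0 := Icc_subset_Icc hρle le_rfl
  set K : Set (EuclideanSpace ℝ (Fin 3)) := closedBall 0 r₁ with hK
  have hKc : IsCompact K := isCompact_closedBall _ _
  have hKρ : K ⊆ closedBall 0 ρ := closedBall_subset_closedBall hr₁
  -- ### the nonlinearity `H = χ_ε^{1/4}` and its weight
  obtain ⟨hHC, hHpos0, hHeq0, hHd1, hHd2⟩ := clampedPow_props hε (1 / 4 : ℝ)
  obtain ⟨H, hHdef⟩ : ∃ H : ℝ → ℝ, ∀ v, H v = smoothMax (ε / 4) v (ε / 4) ^ (1 / 4 : ℝ) := ⟨_, fun _ => rfl⟩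
  have hHfun : (fun v : ℝ => smoothMax (ε / 4) v (ε / 4) ^ (1 / 4 : ℝ)) = H := funext fun v => (hHdef v).symm
  rw [hHfun] at hHC hHd1 hHd2
  have hHpos : ∀ v, 0 < H v := fun v => by rw [hHdef]; exact hHpos0 v
  have hHeq : ∀ v, ε / 2 ≤ v → H v = v ^ (1 / 4 : ℝ) := fun v hv => by rw [hHdef]; exact hHeq0 v hv
  have hH : ContDiff ℝ 2 H := hHC 2
  obtain ⟨κ, hκdef⟩ : ∃ κ : ℝ, κ = 1 / 3 := ⟨_, rfl⟩
  have hκpos : 0 < κ := by rw [hκdef]; norm_num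
  obtain ⟨Gw, hGwdef⟩ : ∃ Gw : ℝ → ℝ, ∀ v, Gw v = deriv H v ^ 2 / (κ * H v) := ⟨_, fun _ => rfl⟩
  have hHdc : Continuous (deriv H) := hH.continuous_deriv (by norm_num)
  have hGwc : Continuous Gw := by
    have h : Continuous fun v => deriv H v ^ 2 / (κ * H v) :=
      (hHdc.pow 2).div (continuous_const.mul hH.continuous) fun v => mul_ne_zero hκpos.ne' (hHpos v).ne'
    exact h.congr fun v => (hGwdef v).symm
  have hGw0 : ∀ v, 0 ≤ Gw v := fun v => by
    rw [hGwdef v]; exact div_nonneg (sq_nonneg _) (mul_nonneg hκpos.le (hHpos v).le)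
  have hκ : ∀ v, deriv H v ^ 2 ≤ κ * H v * Gw v := fun v => by
    have hne : κ * H v ≠ 0 := mul_ne_zero hκpos.ne' (hHpos v).ne'
    rw [hGwdef v, mul_div_cancel₀ _ hne]
  -- `H'' = −Gw` on the range `v > ε/2`
  have hGrange : ∀ v, ε / 2 < v → deriv (deriv H) v = -Gw v := by
    intro v hv
    have hv0 : 0 < v := (half_pos hε).trans hv
    have hHv : H v = v ^ (1 / 4 : ℝ) := hHeq v hv.le
    have e1 : ((1 / 4 : ℝ) * v ^ ((1 / 4 : ℝ) - 1)) ^ 2 = 1 / 16 * (v ^ ((1 / 4 : ℝ) - 2) * v ^ (1 / 4 : ℝ)) := by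
      rw [mul_pow, ← Real.rpow_natCast (v ^ ((1 / 4 : ℝ) - 1)) 2, ← Real.rpow_mul hv0.le,
        ← Real.rpow_add hv0]
      norm_num
    have hGwv : Gw v = 3 / 16 * v ^ ((1 / 4 : ℝ) - 2) := by
      rw [hGwdef v, hHd1 v hv, hHv, e1, hκdef]
      have hvq : v ^ (1 / 4 : ℝ) ≠ 0 := (Real.rpow_pos_of_pos hv0 _).ne'
      field_simp
    rw [hHd2 v hv, hGwv]
    ring
  -- ### the cut-offs
  set φ : EuclideanSpace ℝ (Fin 3) → ℝ := radialCutoff r₂ r₁ with hφdef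
  have hφ : ContDiff ℝ 2 φ := radialCutoff_contDiff r₂ r₁
  have hφ1C : ContDiff ℝ 1 φ := radialCutoff_contDiff r₂ r₁
  have hφc : HasCompactSupport φ := hasCompactSupport_radialCutoff hr₂.le hr
  have hφa : IsAxisymmetricScalar φ := radialCutoff_axisymmetric r₂ r₁
  have hφr : ∀ x, φ x * fderiv ℝ φ x (eR x) ≤ 0 := radialCutoff_mul_fderiv_eR_nonpos hr hr₂.le
  have hφ1 : ∀ x ∈ ball (0 : EuclideanSpace ℝ (Fin 3)) r₂, φ x = 1 := fun x hx =>
    radialCutoff_eq_one hr₂.le hr (le_of_lt (mem_ball_zero_iff.1 hx))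
  have hφ1' : ∀ x ∈ closedBall (0 : EuclideanSpace ℝ (Fin 3)) r₂, φ x = 1 := fun x hx =>
    radialCutoff_eq_one hr₂.le hr (mem_closedBall_zero_iff.1 hx)
  have hφK : tsupport φ ⊆ K := tsupport_radialCutoff_subset_closedBall hr₂.le hr
  have hφ01 : ∀ x, 0 ≤ φ x ∧ φ x ≤ 1 := fun x => ⟨radialCutoff_nonneg _ _ _, radialCutoff_le_one _ _ _⟩
  set D : ℝ := Cφ / (r₁ - r₂) with hD
  have hφD : ∀ x, ‖gradient φ x‖ ≤ D := fun x => hCφ r₂ r₁ hr₂.le hr x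
  have hD0 : 0 ≤ D := (norm_nonneg _).trans (hφD 0)
  have hw : 0 < r₁ ^ 2 / 4 := by positivity
  obtain ⟨hηC, hη1, hη2, hη010, hηmid0, hηD⟩ := timeCutoff₂_props (T := r₁ ^ 2) (w := r₁ ^ 2 / 4) hw hCT
  obtain ⟨η, hηdef⟩ : ∃ η : ℝ → ℝ, ∀ s, η s = Real.smoothTransition ((s + r₁ ^ 2) / (r₁ ^ 2 / 4)) *
      Real.smoothTransition (-s / (r₁ ^ 2 / 4)) := ⟨_, fun _ => rfl⟩
  have hηfun : (fun s : ℝ => Real.smoothTransition ((s + r₁ ^ 2) / (r₁ ^ 2 / 4)) *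
      Real.smoothTransition (-s / (r₁ ^ 2 / 4))) = η := funext fun s => (hηdef s).symm
  rw [hηfun] at hηC hηD
  have hη01 : ∀ s, 0 ≤ η s ∧ η s ≤ 1 := fun s => by rw [hηdef]; exact hη010 s
  have hηmid : ∀ s, -r₁ ^ 2 + r₁ ^ 2 / 4 ≤ s → s ≤ -(r₁ ^ 2 / 4) → η s = 1 := fun s h1 h2 => by
    rw [hηdef]; exact hηmid0 s h1 h2
  set D' : ℝ := 2 * CT / (r₁ ^ 2 / 4) with hD'
  have hD'0 : 0 ≤ D' := (abs_nonneg _).trans (hηD 0)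
  have hη0 : η (-r₁ ^ 2) = 0 := by
    rw [hηdef, show -r₁ ^ 2 = -(r₁ ^ 2) by ring]; exact hη1
  have hη00 : η 0 = 0 := by rw [hηdef]; exact hη2
  -- support facts
  have hφ0K : ∀ x, x ∉ K → φ x = 0 := fun x hx => image_eq_zero_of_notMem_tsupport fun h => hx (hφK h)
  have hφ2 : ContDiff ℝ 1 fun y => φ y ^ 2 := hφ1C.pow 2
  have hgradφ2c : Continuous (gradient fun y => φ y ^ 2) := continuous_gradient_of_contDiff hφ2
  have htsupp2 : tsupport (fun y => φ y ^ 2) ⊆ K := by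
    refine (closure_mono ?_).trans ((isClosed_closedBall).closure_subset_iff.2 (subset_tsupport _ |>.trans hφK))
    intro x hx
    simp only [mem_support, ne_eq, pow_eq_zero_iff, OfNat.ofNat_ne_zero, not_false_eq_true] at hx
    exact hx
  have hgradφ2K : ∀ x, x ∉ K → gradient (fun y => φ y ^ 2) x = 0 := fun x hx =>
    gradient_eq_zero_of_notMem_tsupport fun h => hx (htsupp2 h)
  have hfderivφ2K : ∀ x, x ∉ K → fderiv ℝ (fun y => φ y ^ 2) x = 0 := fun x hx =>
    fderiv_of_notMem_tsupport ℝ fun h => hx (htsupp2 h)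
  obtain ⟨D₂, hD₂⟩ : ∃ D₂, ∀ x, ‖gradient (fun y => φ y ^ 2) x‖ ≤ D₂ :=
    hgradφ2c.bounded_above_of_compact_support (HasCompactSupport.intro hKc fun x hx => hgradφ2K x hx)
  -- ### bounds for `H(F)`, `H'(F)` on `[−r₁², 0] × K`
  have hHFc : Continuous fun p : ℝ × EuclideanSpace ℝ (Fin 3) => H (F p.1 p.2) := hH.continuous.comp hFc
  have hH'c : Continuous (deriv H) := hH.continuous_deriv (by norm_num)
  have hH''c : Continuous (deriv (deriv H)) := by
    have h2 : ContDiff ℝ (1 + 1) H := by rw [one_add_one_eq_two]; exact hH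
    exact h2.deriv'.continuous_deriv le_rfl
  have hH'Fc : Continuous fun p : ℝ × EuclideanSpace ℝ (Fin 3) => deriv H (F p.1 p.2) := hH'c.comp hFc
  have hcpt : IsCompact (Icc (-r₁ ^ 2) (0 : ℝ) ×ˢ K) := isCompact_Icc.prod hKc
  obtain ⟨CH, hCH⟩ : ∃ C, ∀ p ∈ Icc (-r₁ ^ 2) (0 : ℝ) ×ˢ K, ‖H (F p.1 p.2)‖ ≤ C :=
    hcpt.exists_bound_of_continuousOn hHFc.continuousOn
  obtain ⟨CH', hCH'⟩ : ∃ C, ∀ p ∈ Icc (-r₁ ^ 2) (0 : ℝ) ×ˢ K, ‖deriv H (F p.1 p.2)‖ ≤ C :=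
    hcpt.exists_bound_of_continuousOn hH'Fc.continuousOn
  -- a global bound for `H(F)` on `ℝ × K` is not available; we only need it for `s ∈ (−r₁², 0]`.
  -- ### restrictions of the equation data to `[−r₁², 0]`
  have hBst' : ∀ᵐ s ∂(volume.restrict (Ioc (-r₁ ^ 2) 0)),
      Differentiable ℝ (Bst s) ∧ curl (Bst s) =ᵐ[volume] b s := by
    filter_upwards [ae_restrict_of_ae_restrict_of_subset hI hBst] with s hs
    exact ⟨hs.1, hs.2.1⟩
  have heq' : ∀ᵐ x ∂(volume : Measure (EuclideanSpace ℝ (Fin 3))),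
      IntervalIntegrable (fun s => N s x) volume (-r₁ ^ 2) 0 ∧
        ∀ s ∈ Icc (-r₁ ^ 2) 0, F s x = F (-r₁ ^ 2) x + ∫ τ in (-r₁ ^ 2)..s, N τ x := by
    filter_upwards [heq] with x hx
    exact integrated_eq_rebase (Fx := fun s => F s x) (Nx := fun s => N s x) hρle hn0
      hx.1 hx.2
  -- ### the space–time integrability of the tested equation
  have hint : Integrable (fun p : ℝ × EuclideanSpace ℝ (Fin 3) =>
      (deriv H (F p.1 p.2) * N p.1 p.2 * η p.1 + H (F p.1 p.2) * deriv η p.1) * φ p.2 ^ 2)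
      ((volume.restrict (Ioc (-r₁ ^ 2) 0)).prod volume) := by
    -- the measure and its null sets
    set μ₁ : Measure (ℝ × EuclideanSpace ℝ (Fin 3)) := (volume.restrict (Ioc (-r₁ ^ 2) 0)).prod volume
      with hμ₁
    have hNm₁ : AEStronglyMeasurable (fun p : ℝ × EuclideanSpace ℝ (Fin 3) => N p.1 p.2) μ₁ :=
      hNm.mono_measure (Measure.prod_mono (Measure.restrict_mono hI le_rfl) le_rfl)
    have hηc : Continuous η := hηC.continuous
    have hη'c : Continuous (deriv η) := hηC.continuous_deriv le_rfl
    have hfm : AEStronglyMeasurable (fun p : ℝ × EuclideanSpace ℝ (Fin 3) =>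
        (deriv H (F p.1 p.2) * N p.1 p.2 * η p.1 + H (F p.1 p.2) * deriv η p.1) * φ p.2 ^ 2) μ₁ := by
      refine AEStronglyMeasurable.mul (AEStronglyMeasurable.add ?_ ?_) ?_
      · exact (hH'Fc.aestronglyMeasurable.mul hNm₁).mul (hηc.comp continuous_fst).aestronglyMeasurable
      · exact (hHFc.mul (hη'c.comp continuous_fst)).aestronglyMeasurable
      · exact ((hφ.continuous.comp continuous_snd).pow 2).aestronglyMeasurable
    -- the dominating function `1_K(x) (C_H' |N| + C_H D')`
    set g : ℝ × EuclideanSpace ℝ (Fin 3) → ℝ := fun p =>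
      (univ ×ˢ K : Set (ℝ × EuclideanSpace ℝ (Fin 3))).indicator
        (fun p => CH' * ‖N p.1 p.2‖ + CH * D') p with hg
    have hgi : Integrable g μ₁ := by
      rw [hg, integrable_indicator_iff (MeasurableSet.univ.prod hKc.measurableSet)]
      have hres : μ₁.restrict (univ ×ˢ K) = (volume.restrict (Ioc (-r₁ ^ 2) 0)).prod (volume.restrict K) := by
        rw [hμ₁, ← Measure.restrict_univ (μ := volume.restrict (Ioc (-r₁ ^ 2) (0:ℝ))),
          Measure.prod_restrict, Measure.restrict_univ]
      rw [IntegrableOn, hres]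
      have hNi₁ : Integrable (fun p : ℝ × EuclideanSpace ℝ (Fin 3) => N p.1 p.2)
          ((volume.restrict (Ioc (-r₁ ^ 2) 0)).prod (volume.restrict K)) :=
        hNi.mono_measure (Measure.prod_mono (Measure.restrict_mono hI le_rfl) (Measure.restrict_mono hKρ le_rfl))
      haveI : IsFiniteMeasure ((volume.restrict (Ioc (-r₁ ^ 2) (0:ℝ))).prod (volume.restrict K)) := by
        haveI : IsFiniteMeasure (volume.restrict (Ioc (-r₁ ^ 2) (0:ℝ))) := ⟨by
          rw [Measure.restrict_apply_univ]; exact measure_Ioc_lt_top⟩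
        haveI : IsFiniteMeasure ((volume : Measure (EuclideanSpace ℝ (Fin 3))).restrict K) := ⟨by
          rw [Measure.restrict_apply_univ]; exact hKc.measure_lt_top⟩
        infer_instance
      exact (hNi₁.norm.const_mul CH').add (integrable_const _)
    refine hgi.mono' hfm ?_
    -- the pointwise bound, for a.e. `p` (those with `p.1 ∈ (−r₁², 0]`)
    have hmem : ∀ᵐ p ∂μ₁, p.1 ∈ Ioc (-r₁ ^ 2) (0 : ℝ) := by
      rw [hμ₁, Measure.restrict_prod_eq_prod_univ]
      filter_upwards [ae_restrict_mem (measurableSet_Ioc.prod MeasurableSet.univ)] with p hp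
      exact hp.1
    filter_upwards [hmem] with p hp
    by_cases hx : p.2 ∈ K
    · have hpI : p ∈ Icc (-r₁ ^ 2) (0 : ℝ) ×ˢ K := ⟨Ioc_subset_Icc_self hp, hx⟩
      simp only [hg]
      rw [indicator_of_mem (show p ∈ (univ ×ˢ K : Set _) from ⟨mem_univ _, hx⟩)]
      have h1 : ‖deriv H (F p.1 p.2)‖ ≤ CH' := hCH' p hpI
      have h2 : ‖H (F p.1 p.2)‖ ≤ CH := hCH p hpI
      have h3 : |η p.1| ≤ 1 := by rw [abs_of_nonneg (hη01 p.1).1]; exact (hη01 p.1).2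
      have h4 : |deriv η p.1| ≤ D' := hηD p.1
      have h5 : φ p.2 ^ 2 ≤ 1 := pow_le_one₀ (hφ01 p.2).1 (hφ01 p.2).2
      have hCH0 : 0 ≤ CH := (norm_nonneg _).trans h2
      have hCH'0 : 0 ≤ CH' := (norm_nonneg _).trans h1
      rw [Real.norm_eq_abs, abs_mul, abs_of_nonneg (sq_nonneg (φ p.2))]
      calc |deriv H (F p.1 p.2) * N p.1 p.2 * η p.1 + H (F p.1 p.2) * deriv η p.1| * φ p.2 ^ 2
          ≤ (|deriv H (F p.1 p.2)| * |N p.1 p.2| * |η p.1| + |H (F p.1 p.2)| * |deriv η p.1|) * 1 := by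
            refine mul_le_mul ((abs_add_le _ _).trans (by rw [abs_mul, abs_mul, abs_mul])) h5 (sq_nonneg _)
              (by positivity)
        _ ≤ CH' * ‖N p.1 p.2‖ + CH * D' := by
            rw [mul_one, Real.norm_eq_abs]
            refine add_le_add ?_ ?_
            · calc |deriv H (F p.1 p.2)| * |N p.1 p.2| * |η p.1| ≤ CH' * |N p.1 p.2| * 1 := by
                    refine mul_le_mul (mul_le_mul_of_nonneg_right ((Real.norm_eq_abs _).symm.le.trans h1)
                      (abs_nonneg _)) h3 (abs_nonneg _) (by positivity)
                _ = CH' * |N p.1 p.2| := mul_one _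
            · exact mul_le_mul ((Real.norm_eq_abs _).symm.le.trans h2) h4 (abs_nonneg _) hCH0
    · rw [hφ0K p.2 hx]
      simp only [hg]
      rw [indicator_of_notMem (show p ∉ (univ ×ˢ K : Set _) from fun h => hx h.2)]
      simp
  -- ### the slice functionals and their integrability in time
  have hGc : Continuous fun s => ∫ x, deriv (deriv H) (F s x) * ‖gradient (F s) x‖ ^ 2 * φ x ^ 2 :=
    continuous_integral_of_continuous_of_support
      ((( hH''c.comp hFc).mul (hF1c.norm.pow 2)).mul ((hφ.continuous.comp continuous_snd).pow 2))
      hKc (fun s x hx => by rw [hφ0K x hx]; ring)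
  have hMc : Continuous fun s => ∫ x, H (F s x) * φ x ^ 2 :=
    continuous_integral_of_continuous_of_support (hHFc.mul ((hφ.continuous.comp continuous_snd).pow 2))
      hKc (fun s x hx => by rw [hφ0K x hx]; ring)
  have hT₁c : Continuous fun s => ∫ x, deriv H (F s x) * ⟪gradient (F s) x, gradient (fun y => φ y ^ 2) x⟫ :=
    continuous_integral_of_continuous_of_support
      (hH'Fc.mul (hF1c.inner (hgradφ2c.comp continuous_snd)))
      hKc (fun s x hx => by rw [hgradφ2K x hx, inner_zero_right, mul_zero])
  -- `T₂`: bounded jointly measurable integrand supported in `K`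
  have hT₂i : IntervalIntegrable (fun s => ∫ x, H (F s x) * ⟪b s x, gradient (fun y => φ y ^ 2) x⟫)
      volume (-r₁ ^ 2) 0 := by
    have hf : Integrable (fun p : ℝ × EuclideanSpace ℝ (Fin 3) =>
        H (F p.1 p.2) * ⟪b p.1 p.2, gradient (fun y => φ y ^ 2) p.2⟫)
        ((volume.restrict (Ioc (-r₁ ^ 2) 0)).prod volume) := by
      refine integrable_prod_of_le_mul_one_add_inv_cylRadius (K := K) hKc ?_ ?_ (C := CH * Mb * D₂) ?_
      · have hbm₁ := hbm.mono_measure (Measure.prod_mono (Measure.restrict_mono hI le_rfl) le_rfl)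
        exact hHFc.aestronglyMeasurable.mul (hbm₁.inner (hgradφ2c.comp continuous_snd).aestronglyMeasurable)
      · intro s x hx
        show H (F s x) * ⟪b s x, gradient (fun y => φ y ^ 2) x⟫ = 0
        rw [hgradφ2K x hx, inner_zero_right, mul_zero]
      · intro s hs x hx
        show |H (F s x) * ⟪b s x, gradient (fun y => φ y ^ 2) x⟫| ≤ CH * Mb * D₂ * (1 + (cylRadius x)⁻¹)
        have h1 : ‖H (F s x)‖ ≤ CH := hCH (s, x) ⟨Ioc_subset_Icc_self hs, hx⟩
        have h2 : ‖b s x‖ ≤ Mb := hbB s x (hKρ hx)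
        have h3 := hD₂ x
        have hr0 : 0 ≤ (cylRadius x)⁻¹ := inv_nonneg.2 (cylRadius_nonneg x)
        have hCH0 : 0 ≤ CH := (norm_nonneg _).trans h1
        have hMb0 : 0 ≤ Mb := (norm_nonneg _).trans h2
        calc |H (F s x) * ⟪b s x, gradient (fun y => φ y ^ 2) x⟫|
            = |H (F s x)| * |⟪b s x, gradient (fun y => φ y ^ 2) x⟫| := abs_mul _ _
          _ ≤ CH * (Mb * D₂) := by
              refine mul_le_mul ((Real.norm_eq_abs _).symm.le.trans h1)
                ((abs_real_inner_le_norm _ _).trans (mul_le_mul h2 h3 (norm_nonneg _) hMb0))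
                (abs_nonneg _) hCH0
          _ = CH * Mb * D₂ * 1 := by ring
          _ ≤ CH * Mb * D₂ * (1 + (cylRadius x)⁻¹) := by
              refine mul_le_mul_of_nonneg_left (le_add_of_nonneg_right hr0) ?_
              exact mul_nonneg (mul_nonneg hCH0 hMb0) ((norm_nonneg _).trans h3)
    have h := hf.integral_prod_left
    exact (intervalIntegrable_iff_integrableOn_Ioc_of_le hn0).2 h
  -- `T₃`: the axis term, integrand bounded by `C (1 + 1/r)` on `K`
  have hT₃i : IntervalIntegrable
      (fun s => ∫ x, 2 / cylRadius x * (H (F s x) * fderiv ℝ (fun y => φ y ^ 2) x (eR x)))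
      volume (-r₁ ^ 2) 0 := by
    obtain ⟨D₃, hD₃⟩ : ∃ D₃, ∀ x, ‖fderiv ℝ (fun y => φ y ^ 2) x‖ ≤ D₃ :=
      (hφ2.continuous_fderiv one_ne_zero).bounded_above_of_compact_support
        (HasCompactSupport.intro hKc fun x hx => hfderivφ2K x hx)
    have hD₃0 : 0 ≤ D₃ := (norm_nonneg _).trans (hD₃ 0)
    have hf : Integrable (fun p : ℝ × EuclideanSpace ℝ (Fin 3) =>
        2 / cylRadius p.2 * (H (F p.1 p.2) * fderiv ℝ (fun y => φ y ^ 2) p.2 (eR p.2)))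
        ((volume.restrict (Ioc (-r₁ ^ 2) 0)).prod volume) := by
      refine integrable_prod_of_le_mul_one_add_inv_cylRadius (K := K) hKc ?_ ?_ (C := 2 * (CH * D₃)) ?_
      · -- measurability
        have h1 : Measurable fun p : ℝ × EuclideanSpace ℝ (Fin 3) => 2 / cylRadius p.2 :=
          measurable_const.div (continuous_cylRadius.measurable.comp measurable_snd)
        have h2 : Measurable fun p : ℝ × EuclideanSpace ℝ (Fin 3) =>
            fderiv ℝ (fun y => φ y ^ 2) p.2 (eR p.2) := by
          have h : Measurable fun p : ℝ × EuclideanSpace ℝ (Fin 3) =>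
              ⟪gradient (fun y => φ y ^ 2) p.2, eR p.2⟫ :=
            Measurable.inner (hgradφ2c.measurable.comp measurable_snd) (measurable_eR.comp measurable_snd)
          -- `⟪∇(φ²), e_r⟫ = D(φ²)[e_r]`
          have e : (fun p : ℝ × EuclideanSpace ℝ (Fin 3) => fderiv ℝ (fun y => φ y ^ 2) p.2 (eR p.2)) =
              fun p => ⟪gradient (fun y => φ y ^ 2) p.2, eR p.2⟫ :=
            funext fun p => (inner_gradient_left (fun y => φ y ^ 2) p.2 (eR p.2)).symm
          rw [e]; exact h
        exact h1.aestronglyMeasurable.mul (hHFc.aestronglyMeasurable.mul h2.aestronglyMeasurable)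
      · intro s x hx
        show 2 / cylRadius x * (H (F s x) * fderiv ℝ (fun y => φ y ^ 2) x (eR x)) = 0
        rw [hfderivφ2K x hx]; simp
      · intro s hs x hx
        show |2 / cylRadius x * (H (F s x) * fderiv ℝ (fun y => φ y ^ 2) x (eR x))| ≤
          2 * (CH * D₃) * (1 + (cylRadius x)⁻¹)
        have h1 : ‖H (F s x)‖ ≤ CH := hCH (s, x) ⟨Ioc_subset_Icc_self hs, hx⟩
        have hCH0 : 0 ≤ CH := (norm_nonneg _).trans h1
        have h2 : ‖fderiv ℝ (fun y => φ y ^ 2) x (eR x)‖ ≤ D₃ := by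
          calc ‖fderiv ℝ (fun y => φ y ^ 2) x (eR x)‖ ≤ ‖fderiv ℝ (fun y => φ y ^ 2) x‖ * ‖eR x‖ :=
                ContinuousLinearMap.le_opNorm _ _
            _ ≤ D₃ * 1 := mul_le_mul (hD₃ x) (norm_eR_le_one x) (norm_nonneg _) hD₃0
            _ = D₃ := mul_one _
        have hr0 : 0 ≤ (cylRadius x)⁻¹ := inv_nonneg.2 (cylRadius_nonneg x)
        rw [abs_mul, abs_div, abs_two, abs_of_nonneg (cylRadius_nonneg x), abs_mul, div_eq_mul_inv]
        have h3 : |H (F s x)| * |fderiv ℝ (fun y => φ y ^ 2) x (eR x)| ≤ CH * D₃ :=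
          mul_le_mul ((Real.norm_eq_abs _).symm.le.trans h1) ((Real.norm_eq_abs _).symm.le.trans h2)
            (abs_nonneg _) hCH0
        calc 2 * (cylRadius x)⁻¹ * (|H (F s x)| * |fderiv ℝ (fun y => φ y ^ 2) x (eR x)|)
            ≤ 2 * (cylRadius x)⁻¹ * (CH * D₃) := mul_le_mul_of_nonneg_left h3 (by positivity)
          _ = 2 * (CH * D₃) * (cylRadius x)⁻¹ := by ring
          _ ≤ 2 * (CH * D₃) * (cylRadius x)⁻¹ + 2 * (CH * D₃) * 1 :=
              le_add_of_nonneg_right (mul_nonneg (mul_nonneg zero_le_two (mul_nonneg hCH0 hD₃0)) zero_le_one)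
          _ = 2 * (CH * D₃) * (1 + (cylRadius x)⁻¹) := by ring
    have h := hf.integral_prod_left
    exact (intervalIntegrable_iff_integrableOn_Ioc_of_le hn0).2 h
  -- ### `H'' = −Gw` on the cylinder
  have hG : ∀ s ∈ Icc (-r₁ ^ 2) 0, ∀ x ∈ K, deriv (deriv H) (F s x) = -Gw (F s x) := by
    intro s hs x hx
    have hlo := (hFb s (hIcc hs) x (hKρ hx)).1
    exact hGrange _ ((half_lt_self hε).trans_le hlo)
  -- ### the axis weight of the cut-off
  have hCax : 0 ≤ 8 * CT / (r₁ ^ 2 - r₂ ^ 2) := div_nonneg (by positivity) hsub0.le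
  have hφax : ∀ x, |2 / cylRadius x * fderiv ℝ (fun y => φ y ^ 2) x (eR x)| ≤ 8 * CT / (r₁ ^ 2 - r₂ ^ 2) * φ x :=
    fun x => abs_axis_weight_radialCutoff_sq_le hr₂.le hr hCT x
  -- ### the boundary functional `Bd` and its integrability
  set Bd : ℝ → ℝ := fun s => 2 * radialConst₂ *
    ∫ z : ℝ, H (F s (meridianPoint (0, z))) * φ (meridianPoint (0, z)) ^ 2 with hBddef
  have hmpc : Continuous fun z : ℝ => meridianPoint (0, z) :=
    (contDiff_meridianPoint (n := 0)).continuous.comp (continuous_const.prodMk continuous_id)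
  have hφmp0 : ∀ z : ℝ, z ∉ Icc (-r₁) r₁ → φ (meridianPoint (0, z)) = 0 := by
    intro z hz
    apply hφ0K
    rw [hK, mem_closedBall_zero_iff, norm_meridianPoint_zero, abs_le]
    rwa [mem_Icc] at hz
  have hBdic : Continuous fun s => ∫ z : ℝ, H (F s (meridianPoint (0, z))) * φ (meridianPoint (0, z)) ^ 2 := by
    have hjc : Continuous fun p : ℝ × ℝ => H (F p.1 (meridianPoint (0, p.2))) * φ (meridianPoint (0, p.2)) ^ 2 :=
      (hHFc.comp (continuous_fst.prodMk (hmpc.comp continuous_snd))).mul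
        ((hφ.continuous.comp (hmpc.comp continuous_snd)).pow 2)
    have h := continuous_parametric_integral_of_continuous (μ := (volume : Measure ℝ))
      (f := fun s z => H (F s (meridianPoint (0, z))) * φ (meridianPoint (0, z)) ^ 2) hjc isCompact_Icc
      (s := Icc (-r₁) r₁)
    refine h.congr fun s => ?_
    exact setIntegral_eq_integral_of_forall_compl_eq_zero fun z hz => by rw [hφmp0 z hz]; ring
  have hBdc : Continuous Bd := continuous_const.mul hBdic
  -- ### the John–Nirenberg `L⁶` bound, for a.e. `s`
  classical
  set c : ℝ → EuclideanSpace ℝ (Fin 3) := fun s =>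
    if h : Differentiable ℝ (Bst s) ∧ eBMOSeminormVec (Bst s) ≤ CB then
      Classical.choose (hCJ (Bst s) h.1.continuous CB h.2 r₁ hr₁0) else 0 with hcdef
  set Vb : ℝ := volume.real (ball (0 : EuclideanSpace ℝ (Fin 3)) r₁) with hVb
  have hc : ∀ᵐ s ∂(volume.restrict (Ioc (-r₁ ^ 2) 0)),
      (∫ x in K, (‖Bst s x - c s‖ ^ 2) ^ (3 : ℝ)) ^ (1 / (3 : ℝ)) ≤ CJ * (CB : ℝ) ^ 2 * Vb ^ (1 / (3 : ℝ)) := by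
    filter_upwards [ae_restrict_of_ae_restrict_of_subset hI hBst] with s hs
    have hcond : Differentiable ℝ (Bst s) ∧ eBMOSeminormVec (Bst s) ≤ CB := ⟨hs.1, hs.2.2⟩
    have hcs : c s = Classical.choose (hCJ (Bst s) hcond.1.continuous CB hcond.2 r₁ hr₁0) := by
      simp only [hcdef, dif_pos hcond]
    rw [hcs]
    exact Classical.choose_spec (hCJ (Bst s) hcond.1.continuous CB hcond.2 r₁ hr₁0)
  have hCJ6 : 0 ≤ CJ * (CB : ℝ) ^ 2 * Vb ^ (1 / (3 : ℝ)) := by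
    have : 0 ≤ Vb := measureReal_nonneg
    positivity
  -- ### apply the analytic core
  have hcore := lower_mass_core (T₁ := r₁ ^ 2) (by positivity) hF2 hFa hb hBst' hN heq' hH hHpos hGwc hGw0
    (κ := κ) hκpos.le hκ hKc hG hφ hφc hφa hφK hφ01 hφD hCax hφax hηC hη0 hη00 hη01 hηD hint
    (G₁ := fun s => ∫ x, deriv (deriv H) (F s x) * ‖gradient (F s) x‖ ^ 2 * φ x ^ 2)
    (T₁f := fun s => ∫ x, deriv H (F s x) * ⟪gradient (F s) x, gradient (fun y => φ y ^ 2) x⟫)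
    (T₂f := fun s => ∫ x, H (F s x) * ⟪b s x, gradient (fun y => φ y ^ 2) x⟫)
    (T₃f := fun s => ∫ x, 2 / cylRadius x * (H (F s x) * fderiv ℝ (fun y => φ y ^ 2) x (eR x)))
    (M := fun s => ∫ x, H (F s x) * φ x ^ 2) (Bd := Bd)
    (fun s => rfl) (fun s => rfl) (fun s => rfl) (fun s => rfl) (fun s => rfl) (fun s => rfl)
    (hGc.intervalIntegrable _ _) (hT₁c.intervalIntegrable _ _) hT₂i hT₃i (hMc.intervalIntegrable _ _)
    (hBdc.intervalIntegrable _ _) hCJ6 hc hHFc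
  -- ### the lower bound of the boundary term: `∫ η Bd ≥ 2π ρ³`
  have hBdlo : ∀ s ∈ Icc (-r₁ ^ 2) 0, 2 * radialConst₂ * r₁ ≤ Bd s := by
    intro s hs
    simp only [hBddef]
    refine mul_le_mul_of_nonneg_left ?_ (by positivity)
    -- `∫_z ≥ ∫_{|z| ≤ r₁/2} 1 = r₁`
    have hnn : ∀ z, 0 ≤ H (F s (meridianPoint (0, z))) * φ (meridianPoint (0, z)) ^ 2 := fun z =>
      mul_nonneg (hHpos _).le (sq_nonneg _)
    have hone : ∀ z ∈ Icc (-(r₁ / 2)) (r₁ / 2), (1 : ℝ) ≤ H (F s (meridianPoint (0, z))) * φ (meridianPoint (0, z)) ^ 2 := by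
      intro z hz
      have hzabs : |z| ≤ r₁ / 2 := abs_le.2 ⟨hz.1, hz.2⟩
      have hr₂' : r₁ / 2 = r₂ := by rw [hr₂e, hr₁e]
      have hφ1z : φ (meridianPoint (0, z)) = 1 := by
        refine hφ1' (meridianPoint (0, z)) ?_
        rw [mem_closedBall_zero_iff, norm_meridianPoint_zero, ← hr₂']
        exact hzabs
      have hzρ : |z| ≤ ρ := by
        rw [← hr₁e]; exact hzabs.trans (half_le_self hr₁0.le)
      have hF1 : 1 ≤ F s (meridianPoint (0, z)) := hFax s (hIcc hs) z hzρ
      have hv : ε / 2 ≤ F s (meridianPoint (0, z)) := ((half_le_self hε.le).trans hε1).trans hF1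
      rw [hφ1z, one_pow, mul_one, hHeq _ hv]
      exact Real.one_le_rpow hF1 (by norm_num)
    have hint_z : Integrable (fun z => H (F s (meridianPoint (0, z))) * φ (meridianPoint (0, z)) ^ 2) volume := by
      refine Continuous.integrable_of_hasCompactSupport ?_ ?_
      · exact ((hH.continuous.comp ((hF2 s).continuous.comp hmpc))).mul ((hφ.continuous.comp hmpc).pow 2)
      · exact HasCompactSupport.intro isCompact_Icc fun z hz => by rw [hφmp0 z hz]; ring
    calc r₁ = ∫ z in Icc (-(r₁ / 2)) (r₁ / 2), (1 : ℝ) := by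
          rw [setIntegral_const, smul_eq_mul, mul_one, Real.volume_real_Icc_of_le hr₁half]; ring
      _ ≤ ∫ z in Icc (-(r₁ / 2)) (r₁ / 2), H (F s (meridianPoint (0, z))) * φ (meridianPoint (0, z)) ^ 2 :=
          setIntegral_mono_on (integrableOn_const (by rw [Real.volume_Icc]; exact ENNReal.ofReal_ne_top))
            hint_z.integrableOn measurableSet_Icc hone
      _ ≤ ∫ z, H (F s (meridianPoint (0, z))) * φ (meridianPoint (0, z)) ^ 2 :=
          setIntegral_le_integral hint_z (ae_of_all _ hnn)
  have hLHS : radialConst₂ * r₁ ^ 3 ≤ ∫ s in (-r₁ ^ 2)..0, η s * Bd s := by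
    have hηBd : ∀ s ∈ Icc (-r₁ ^ 2) 0, η s * (2 * radialConst₂ * r₁) ≤ η s * Bd s := fun s hs =>
      mul_le_mul_of_nonneg_left (hBdlo s hs) (hη01 s).1
    have h1 : ∫ s in (-r₁ ^ 2)..0, η s * (2 * radialConst₂ * r₁) ≤ ∫ s in (-r₁ ^ 2)..0, η s * Bd s :=
      intervalIntegral.integral_mono_on hn0 ((hηC.continuous.mul continuous_const).intervalIntegrable _ _)
        ((hBdc.intervalIntegrable _ _).continuousOn_mul hηC.continuous.continuousOn) hηBd
    refine le_trans ?_ h1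
    rw [intervalIntegral.integral_mul_const]
    -- `∫ η ≥ length of [−3r₁²/4, −r₁²/4] = r₁²/2`
    have h2 : r₁ ^ 2 / 2 ≤ ∫ s in (-r₁ ^ 2)..0, η s := by
      have hsub : ∫ s in (-r₁ ^ 2 + r₁ ^ 2 / 4)..(-(r₁ ^ 2 / 4)), η s ≤ ∫ s in (-r₁ ^ 2)..0, η s :=
        intervalIntegral.integral_mono_interval hn1 hn2 hn3
          (ae_of_all _ fun s => (hη01 s).1) (hηC.continuous.intervalIntegrable _ _)
      have hone : ∫ s in (-r₁ ^ 2 + r₁ ^ 2 / 4)..(-(r₁ ^ 2 / 4)), η s = r₁ ^ 2 / 2 := by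
        rw [intervalIntegral.integral_congr (g := fun _ => (1 : ℝ)) (fun s hs => ?_), intervalIntegral.integral_const,
          smul_eq_mul, mul_one]
        · ring
        · rw [uIcc_of_le hn2] at hs
          exact hηmid s hs.1 hs.2
      rw [← hone]
      exact hsub
    calc radialConst₂ * r₁ ^ 3 = r₁ ^ 2 / 2 * (2 * radialConst₂ * r₁) := by ring
      _ ≤ (∫ s in (-r₁ ^ 2)..0, η s) * (2 * radialConst₂ * r₁) :=
          mul_le_mul_of_nonneg_right h2 (by positivity)
  -- ### the upper bound of the right-hand side
  set X : ℝ := ∫ s in (-r₁ ^ 2)..0, ∫ x in K, H (F s x) with hX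
  have hAc : Continuous fun s => ∫ x in K, H (F s x) :=
    continuous_parametric_integral_of_continuous (μ := (volume : Measure (EuclideanSpace ℝ (Fin 3))))
      (f := fun s x => H (F s x)) hHFc hKc
  have hA0 : ∀ s, 0 ≤ ∫ x in K, H (F s x) := fun s => integral_nonneg fun x => (hHpos _).le
  have hX0 : 0 ≤ X := intervalIntegral.integral_nonneg hn0 fun s _ => hA0 s
  -- `Y ≤ 3^{p/2} A` on the cylinder
  have hYle : ∀ s ∈ Icc (-r₁ ^ 2) 0, ∫ x in K, H (F s x) ^ ((3 : ℝ) / 2) ≤ (3 : ℝ) ^ ((1 / 4 : ℝ) / 2) * ∫ x in K, H (F s x) := by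
    intro s hs
    rw [← MeasureTheory.integral_const_mul]
    refine setIntegral_mono_on (((hH.continuous.comp (hF2 s).continuous).rpow_const fun x => Or.inr (by norm_num)).continuousOn.integrableOn_compact hKc)
      ((continuous_const.mul (hH.continuous.comp (hF2 s).continuous)).continuousOn.integrableOn_compact hKc)
      hKc.measurableSet fun x hx => ?_
    obtain ⟨hlo, hhi⟩ := hFb s (hIcc hs) x (hKρ hx)
    have hv : ε / 2 ≤ F s x := (half_le_self hε.le).trans hlo
    show H (F s x) ^ ((3 : ℝ) / 2) ≤ (3 : ℝ) ^ ((1 / 4 : ℝ) / 2) * H (F s x)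
    rw [hHeq _ hv]
    have hF0 : 0 ≤ F s x := hε.le.trans hlo
    rw [← Real.rpow_mul hF0, show (1 / 4 : ℝ) * (3 / 2) = (1 / 4) / 2 + 1 / 4 by norm_num, Real.rpow_add (hε.trans_le hlo)]
    refine mul_le_mul_of_nonneg_right (Real.rpow_le_rpow hF0 hhi (by norm_num)) (Real.rpow_nonneg hF0 _)
  have h23 : ∀ s ∈ Icc (-r₁ ^ 2) 0, (∫ x in K, H (F s x) ^ ((3 : ℝ) / 2)) ^ (2 / (3 : ℝ)) ≤
      (3 : ℝ) ^ ((1 / 4 : ℝ) / 3) * (∫ x in K, H (F s x)) ^ (2 / (3 : ℝ)) := by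
    intro s hs
    have hY0 : 0 ≤ ∫ x in K, H (F s x) ^ ((3 : ℝ) / 2) := integral_nonneg fun x => Real.rpow_nonneg (hHpos _).le _
    calc (∫ x in K, H (F s x) ^ ((3 : ℝ) / 2)) ^ (2 / (3 : ℝ))
        ≤ ((3 : ℝ) ^ ((1 / 4 : ℝ) / 2) * ∫ x in K, H (F s x)) ^ (2 / (3 : ℝ)) := Real.rpow_le_rpow hY0 (hYle s hs) (by norm_num)
      _ = (3 : ℝ) ^ ((1 / 4 : ℝ) / 3) * (∫ x in K, H (F s x)) ^ (2 / (3 : ℝ)) := by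
          rw [Real.mul_rpow (by positivity) (hA0 s), ← Real.rpow_mul (by norm_num)]; norm_num
  have hHolder := intervalIntegral_rpow_two_thirds_le (t₁ := -r₁ ^ 2) hn0 hAc.continuousOn fun s _ => hA0 s
  rw [neg_neg] at hHolder
  -- `∫ R ≤ (c₁/ρ²) X + c₂ ρ^{-1/3} X^{2/3}` with the constants below
  set L₁ : ℝ := 4 * κ * D ^ 2 + 8 * CT / (r₁ ^ 2 - r₂ ^ 2) + D' with hL₁
  set L₂ : ℝ := 4 * κ * D ^ 2 * (CJ * (CB : ℝ) ^ 2 * Vb ^ (1 / (3 : ℝ))) with hL₂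
  have hL₁0 : 0 ≤ L₁ := by rw [hL₁]; have := hκpos.le; positivity
  have hL₂0 : 0 ≤ L₂ := by rw [hL₂]; have := hκpos.le; have : 0 ≤ Vb := measureReal_nonneg; positivity
  have hRHS : ∫ s in (-r₁ ^ 2)..0, (L₁ * (∫ x in K, H (F s x)) + L₂ * (∫ x in K, H (F s x) ^ ((3 : ℝ) / 2)) ^ (2 / (3 : ℝ))) ≤
      L₁ * X + L₂ * ((3 : ℝ) ^ ((1 / 4 : ℝ) / 3) * ((r₁ ^ 2) ^ (1 / (3 : ℝ)) * X ^ (2 / (3 : ℝ)))) := by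
    have hYc : Continuous fun s => ∫ x in K, H (F s x) ^ ((3 : ℝ) / 2) :=
      continuous_parametric_integral_of_continuous (μ := (volume : Measure (EuclideanSpace ℝ (Fin 3))))
        (f := fun s x => H (F s x) ^ ((3 : ℝ) / 2)) (hHFc.rpow_const fun p => Or.inr (by norm_num)) hKc
    have hY23c : Continuous fun s => (∫ x in K, H (F s x) ^ ((3 : ℝ) / 2)) ^ (2 / (3 : ℝ)) :=
      hYc.rpow_const fun s => Or.inr (by norm_num)
    have hA23c : Continuous fun s => (∫ x in K, H (F s x)) ^ (2 / (3 : ℝ)) := hAc.rpow_const fun s => Or.inr (by norm_num)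
    rw [intervalIntegral.integral_add ((hAc.intervalIntegrable _ _).const_mul L₁) ((hY23c.intervalIntegrable _ _).const_mul L₂),
      intervalIntegral.integral_const_mul, intervalIntegral.integral_const_mul]
    refine add_le_add le_rfl (mul_le_mul_of_nonneg_left ?_ hL₂0)
    calc ∫ s in (-r₁ ^ 2)..0, (∫ x in K, H (F s x) ^ ((3 : ℝ) / 2)) ^ (2 / (3 : ℝ))
        ≤ ∫ s in (-r₁ ^ 2)..0, (3 : ℝ) ^ ((1 / 4 : ℝ) / 3) * (∫ x in K, H (F s x)) ^ (2 / (3 : ℝ)) :=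
          intervalIntegral.integral_mono_on hn0 (hY23c.intervalIntegrable _ _)
            ((hA23c.intervalIntegrable _ _).const_mul _) fun s hs => h23 s hs
      _ = (3 : ℝ) ^ ((1 / 4 : ℝ) / 3) * ∫ s in (-r₁ ^ 2)..0, (∫ x in K, H (F s x)) ^ (2 / (3 : ℝ)) :=
          intervalIntegral.integral_const_mul _ _
      _ ≤ (3 : ℝ) ^ ((1 / 4 : ℝ) / 3) * ((r₁ ^ 2) ^ (1 / (3 : ℝ)) * X ^ (2 / (3 : ℝ))) :=
          mul_le_mul_of_nonneg_left hHolder (by positivity)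
  have hmain : radialConst₂ * r₁ ^ 3 ≤ L₁ * X + L₂ * ((3 : ℝ) ^ ((1 / 4 : ℝ) / 3) * ((r₁ ^ 2) ^ (1 / (3 : ℝ)) * X ^ (2 / (3 : ℝ)))) :=
    hLHS.trans (hcore.trans hRHS)
  -- ### the constants: `L₁ ≤ a₁/ρ²`, `L₂ 3^{p/3} (ρ²)^{1/3} ≤ a₂ ρ^{-1/3}`
  have hr₂' : r₂ = r₁ / 2 := by rw [hr₂e, hr₁e]
  have hr₁ne : r₁ ≠ 0 := hr₁0.ne'
  have hr₁2 : 0 < r₁ ^ 2 := by positivity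
  have hD2 : D ^ 2 = 4 * Cφ ^ 2 / r₁ ^ 2 := by
    rw [hD, hr₂', show r₁ - r₁ / 2 = r₁ / 2 by ring, div_pow]
    field_simp
    ring
  have hL₁le : L₁ ≤ a₁ / r₁ ^ 2 := by
    have e : L₁ = (16 * (1 / 3) * Cφ ^ 2 + 56 * CT / 3) / r₁ ^ 2 := by
      rw [hL₁, hD2, hD', hκdef, hr₂', show r₁ ^ 2 - (r₁ / 2) ^ 2 = 3 * r₁ ^ 2 / 4 by ring]
      field_simp
      ring
    rw [e, div_le_div_iff_of_pos_right hr₁2, ha₁]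
    linarith only [hCT0]
  have hVb' : Vb ^ (1 / (3 : ℝ)) ≤ r₁ * V₁ ^ (1 / (3 : ℝ)) := by
    obtain ⟨-, -, hVb0, hVbρ⟩ := volumeReal_ball_le hr₁0 le_rfl
    calc Vb ^ (1 / (3 : ℝ)) ≤ (r₁ ^ 3 * V₁) ^ (1 / (3 : ℝ)) := Real.rpow_le_rpow hVb0 hVbρ (by norm_num)
      _ = r₁ * V₁ ^ (1 / (3 : ℝ)) := by
          rw [Real.mul_rpow (by positivity) hV₁0, ← Real.rpow_natCast r₁ 3, ← Real.rpow_mul hr₁0.le]; norm_num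
  have hT13 : (r₁ ^ 2) ^ (1 / (3 : ℝ)) = r₁ ^ (2 / (3 : ℝ)) := by
    rw [← Real.rpow_natCast r₁ 2, ← Real.rpow_mul hr₁0.le]; norm_num
  have hL₂le : L₂ * ((3 : ℝ) ^ ((1 / 4 : ℝ) / 3) * ((r₁ ^ 2) ^ (1 / (3 : ℝ)) * X ^ (2 / (3 : ℝ)))) ≤
      a₂ * r₁ ^ (-(1 / 3 : ℝ)) * X ^ (2 / (3 : ℝ)) := by
    rw [hT13, hL₂, hD2, hκdef]
    have hX23 : 0 ≤ X ^ (2 / (3 : ℝ)) := Real.rpow_nonneg hX0 _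
    have h3 : 0 ≤ (3 : ℝ) ^ ((1 / 4 : ℝ) / 3) := by positivity
    have hkey : 4 * (1 / 3) * (4 * Cφ ^ 2 / r₁ ^ 2) * (CJ * (CB : ℝ) ^ 2 * Vb ^ (1 / (3 : ℝ))) * (3 : ℝ) ^ ((1 / 4 : ℝ) / 3) * r₁ ^ (2 / (3 : ℝ)) ≤
        a₂ * r₁ ^ (-(1 / 3 : ℝ)) := by
      have hstep : 4 * (1 / 3) * (4 * Cφ ^ 2 / r₁ ^ 2) * (CJ * (CB : ℝ) ^ 2 * Vb ^ (1 / (3 : ℝ))) * (3 : ℝ) ^ ((1 / 4 : ℝ) / 3) * r₁ ^ (2 / (3 : ℝ)) ≤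
          4 * (1 / 3) * (4 * Cφ ^ 2 / r₁ ^ 2) * (CJ * (CB : ℝ) ^ 2 * (r₁ * V₁ ^ (1 / (3 : ℝ)))) * (3 : ℝ) ^ ((1 / 4 : ℝ) / 3) * r₁ ^ (2 / (3 : ℝ)) := by
        gcongr
      refine hstep.trans ?_
      have epow : r₁⁻¹ * r₁ ^ (2 / (3 : ℝ)) = r₁ ^ (-(1 / 3 : ℝ)) := by
        rw [← Real.rpow_neg_one, ← Real.rpow_add hr₁0]; norm_num
      have e : 4 * (1 / 3) * (4 * Cφ ^ 2 / r₁ ^ 2) * (CJ * (CB : ℝ) ^ 2 * (r₁ * V₁ ^ (1 / (3 : ℝ)))) * (3 : ℝ) ^ ((1 / 4 : ℝ) / 3) * r₁ ^ (2 / (3 : ℝ)) =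
          (16 * (1 / 3) * Cφ ^ 2 * (CJ * (CB : ℝ) ^ 2 * V₁ ^ (1 / (3 : ℝ))) * (3 : ℝ) ^ ((1 / 4 : ℝ) / 3)) * (r₁⁻¹ * r₁ ^ (2 / (3 : ℝ))) := by
        field_simp
        ring
      rw [e, epow, ha₂]
      have hpos : 0 ≤ r₁ ^ (-(1 / 3 : ℝ)) := Real.rpow_nonneg hr₁0.le _
      exact mul_le_mul_of_nonneg_right (le_add_of_nonneg_right zero_le_one) hpos
    calc _ = (4 * (1 / 3) * (4 * Cφ ^ 2 / r₁ ^ 2) * (CJ * (CB : ℝ) ^ 2 * Vb ^ (1 / (3 : ℝ))) * (3 : ℝ) ^ ((1 / 4 : ℝ) / 3) * r₁ ^ (2 / (3 : ℝ))) * X ^ (2 / (3 : ℝ)) := by ring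
      _ ≤ (a₂ * r₁ ^ (-(1 / 3 : ℝ))) * X ^ (2 / (3 : ℝ)) := mul_le_mul_of_nonneg_right hkey hX23
      _ = _ := by ring
  have hfinal : radialConst₂ * r₁ ^ 3 ≤ a₁ / r₁ ^ 2 * X + a₂ * r₁ ^ (-(1 / 3 : ℝ)) * X ^ (2 / (3 : ℝ)) := by
    have h1 := mul_le_mul_of_nonneg_right hL₁le hX0
    exact hmain.trans (add_le_add h1 hL₂le)
  -- ### conclude: `X ≥ c ρ⁵` and `X = ∫∫ F^{1/4}`
  -- rescale: `2π ≤ (a₁/ρ⁵) X + (a₂ ρ^{-10/3}) X^{2/3}`, i.e. apply the two-case bound to `B = 2π ρ³`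
  have h2 := le_of_le_add_rpow_two_thirds (B := radialConst₂ * r₁ ^ 3) (by positivity) (by positivity : 0 < a₁ / r₁ ^ 2)
    (by positivity : 0 < a₂ * r₁ ^ (-(1 / 3 : ℝ))) hX0 hfinal
  -- identify the minimum with `cl ρ⁵`
  have hmin : min (radialConst₂ / (2 * a₁)) ((radialConst₂ / (2 * a₂)) ^ (3 / (2 : ℝ))) * r₁ ^ 5 ≤
      min (radialConst₂ * r₁ ^ 3 / (2 * (a₁ / r₁ ^ 2))) ((radialConst₂ * r₁ ^ 3 / (2 * (a₂ * r₁ ^ (-(1 / 3 : ℝ))))) ^ (3 / (2 : ℝ))) := by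
    have e1 : radialConst₂ * r₁ ^ 3 / (2 * (a₁ / r₁ ^ 2)) = radialConst₂ / (2 * a₁) * r₁ ^ 5 := by
      field_simp
    have e2 : (radialConst₂ * r₁ ^ 3 / (2 * (a₂ * r₁ ^ (-(1 / 3 : ℝ))))) ^ (3 / (2 : ℝ)) = (radialConst₂ / (2 * a₂)) ^ (3 / (2 : ℝ)) * r₁ ^ 5 := by
      have e3 : radialConst₂ * r₁ ^ 3 / (2 * (a₂ * r₁ ^ (-(1 / 3 : ℝ)))) = radialConst₂ / (2 * a₂) * r₁ ^ (10 / 3 : ℝ) := by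
        rw [Real.rpow_neg hr₁0.le, show (10 / 3 : ℝ) = 3 + 1 / 3 by norm_num, Real.rpow_add hr₁0,
          Real.rpow_ofNat]
        field_simp
      rw [e3, Real.mul_rpow (by positivity) (Real.rpow_nonneg hr₁0.le _), ← Real.rpow_mul hr₁0.le]
      norm_num
    rw [e1, e2, min_mul_of_nonneg _ _ (by positivity)]
  rw [← hr₁e]
  refine (hmin.trans h2).trans (le_of_eq ?_)
  -- `X = ∫∫ F^{1/4}` (on the cylinder `F ≥ ε ≥ ε/2`, where `H = (·)^{1/4}`)
  simp only [hX]
  refine intervalIntegral.integral_congr fun s hs => ?_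
  rw [uIcc_of_le hn0] at hs
  refine setIntegral_congr_fun measurableSet_closedBall fun x hx => ?_
  show H (F s x) = F s x ^ (1 / 4 : ℝ)
  exact hHeq _ ((half_le_self hε.le).trans (hFb s (hIcc hs) x (hKρ hx)).1)

end LeiZhang2011

end Literature.Analysis.FluidPDE
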